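import Summits.Ventures.WeilGRH.TwistedGramCellCheckC
import Summits.Ventures.WeilGRH.TwistedGramCellCheckH
import Summits.Ventures.WeilGRH.TwistedOddComplexDataRungJ
import HarnessLib

/-!
# GRH arm: twisted format C for ODD COMPLEX characters (parity-1 kernel) — the κ-enumeration CELL checker for the door
  `weilPositivityOnChar_of_twistedOddC_formatC_dataJ` at order `J = 1`, `λ = 1` (kernel functions + soundness + literal `hS` bridge + front door)

Cell `rh-explicit`, WEIL TRACK — GRH ARM (engine seat weil-grh-2 gen11).  Brick 4 of the complex χ-cell lane (bricks 1–3: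
`TwistedGramCellSignsC`, `TwistedGramEntryBoxC`, `TwistedGramCellCheckC`).  The odd complex door (weil-grh-5 gen12) differs from the
parity-0 door `weilPositivityOnChar_of_twistedC_formatC_dataJ` in three places only: the table is `M(κp, κp') = Re K(p,p')` with
`K = twistedGramCoeffOddC χ a = twistedGramCoeffC χ a + (π δ − sechIncrCoeff a)` (the parity bonus; `re_twistedGramCoeffOddC`), the character is
ODD (`hodd : charParity χ = 1`), and the tail is the Peter–Paul combination `(1+θ')·U_C + δ_{ii'}·(1+θ'⁻¹)·c_S`,
`c_S = (2B−1)·2·(a/π²·(1+1/B₃))²/((B₃−B)·d₀)`; the far-weight sign facts `h0`, `hd0`, `hw` are VERBATIM those of the parity-0 door, so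
`signsC_of_checkSignsC` is reused as is.  Accordingly this file reuses brick 3's `entryC` / `uC` / `uCReal` / `mem_uC` / `modeOfIdx` kit and
`TwistedGramCellCheckH`'s bonus box `bonusBoxZ ∋ π δ_{nm} − sechIncrCoeff a n m` (diagonal from the `sechIncrCoeff a n n` table `dtab`, read at
`|n|` — `sechIncrCoeff` is even, `sechIncrCoeff_neg_neg` —, off-diagonal from the sine table `stab`):

* kernel: `entryCO = entryC + bonusBoxZ`, `schurCO`, `cSBox`, `tailCO`, `cellCO`, `checkCellCOHead`, `checkCellCORows i₀ n` (row-split from the start);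
* soundness: `mem_bonusBoxZ_signed`, `mem_entryCO`, `mem_schurCO`, `mem_cSBox`, `mem_tailCO`, `psd_of_checkCellCO` (clean form on `cellCOReal`),
  ★ `hS_of_checkCellCO` — LITERALLY the door's `hS` with `J := 1`, `lam := fun _ ↦ 1`, `θ := θN/θD`, `η := ηN/ηD`, `θ' := θpN/θpD`,
  `d₀ := d0N·2^{−wbits}`, `w j := wN[(j+1)/2 − B]·2^{−wbits}`, `M i i' := Re K(κ_i, κ_{i'})`;
* ★★ front door `weilPositivityOnChar_of_checkCellCO`: data validity (constants, prime data, `Re/Im χ` boxes, `log q`, special-value table below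
  `N > B₃`, sine table below `Ns ≥ B₃`, diagonal `sech` table below `Bd ≥ B`, `CC`, `AOP`) + `hodd` + the four kernel checks ⇒ `WeilPositivityOnChar χ a`.

Pure interval bookkeeping over existing boxes; RH/GRH-free; standard axioms.  References: H. Yoshida (1992) §§5–7 [Yoshida1992HermitianForms];
R. E. Moore (1966) Ch. 3 [Moore1966].
SPLIT (400-line rule, weil-grh-2 gen13): this file = the kernel functions + soundness parts 1–2 (`mem_bonusBoxZ_signed`, `mem_entryCO`, `mem_schurCO`, `mem_cSBox`, `mem_tailCO`); the PSD fact, the bridge `hS_of_checkCellCO` and the front door `weilPositivityOnChar_of_checkCellCO` are in `TwistedGramCellCheckCODoor.lean`.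
-/

set_option autoImplicit false
set_option linter.style.longLine false

open Real Complex Finset MeasureTheory Set
open scoped BigOperators ArithmeticFunction.vonMangoldt ComplexConjugate

namespace Summit.Ventures.WeilGRH

open Literature.NumberTheory.LFunctions Literature.NumberTheory.LFunctions.Yoshida1992
open Literature.NumberTheory.LFunctions.Yoshida1992.Encl
open Literature.Analysis.SpecialFunctions Literature.Analysis.ValidatedNumerics.NumericsMP

namespace TwistedEncl

/-! ## Kernel functions -/

/-- Peter–Paul parameter `θ' = θpN/θpD` of the odd complex door. -/
structure COTailData where
  /-- `θ'` numerator -/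
  θpN : ℕ
  /-- `θ'` denominator -/
  θpD : ℕ
  deriving Repr, Inhabited

/-- Entry box `∋ Re K(κ_i, κ_{i'}) = Re G^χ(κ_i, κ_{i'}) + (π δ − sechIncrCoeff a)(κ_i, κ_{i'})`.
[cite: Yoshida1992HermitianForms, §6 (6.10) p. 303] -/
def entryCO (S : ℕ) (C : Consts) (xs ys : List MI) (LQ : MI) (tab : List IdxRec) (P : MI) (stab dtab : List MI) (i i' : ℕ) : MI :=
  (entryC S C xs ys LQ tab i i').add (bonusBoxZ S P stab dtab (modeOfIdx i) (modeOfIdx i'))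

/-- Schur column sum over the `K`-entries, `Σ_{c<n} K(i, 2B−1+c) K(i', 2B−1+c) · 2^{wbits} / wN[c/2]`.
[cite: Yoshida1992HermitianForms, §7 pp. 305–312] -/
def schurCO (S : ℕ) (C : Consts) (xs ys : List MI) (LQ : MI) (tab : List IdxRec) (P : MI) (stab dtab : List MI)
    (wbits : ℕ) (wN : List ℕ) (B i i' : ℕ) : ℕ → MI
  | 0 => MI.ofInt S 0
  | c + 1 => (schurCO S C xs ys LQ tab P stab dtab wbits wN B i i' c).add
      ((((entryCO S C xs ys LQ tab P stab dtab i (2 * B - 1 + c)).mul S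
        (entryCO S C xs ys LQ tab P stab dtab i' (2 * B - 1 + c))).mulInt ((2 : ℤ) ^ wbits)).divNat (wN.getD (c / 2) 0))

/-- Box of the isotropic `sech` tail constant `c_S = (2B−1)·2·(a/π²·(1+1/B₃))²/((B₃−B)·d₀)`, `d₀ = d0N·2^{−wbits}`.
[cite: Yoshida1992HermitianForms, §7 pp. 305–312] -/
def cSBox (S : ℕ) (C : Consts) (d : CCellData) : MI :=
  let g := (((C.A.mul S C.invPi).mul S C.invPi).mulInt ((d.B3 : ℤ) + 1)).divNat d.B3
  ((g.mul S g).mulInt (2 * ((2 * d.B - 1 : ℕ) : ℤ) * 2 ^ d.wbits)).divNat ((d.B3 - d.B) * d.d0N)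

/-- The odd door's tail box `(1+θ')·U_C(i,i') + δ_{ii'}·(1+θ'⁻¹)·c_S`. [cite: Yoshida1992HermitianForms, §7 pp. 305–312] -/
def tailCO (S : ℕ) (C : Consts) (xs ys : List MI) (tab : List IdxRec) (d : CCellData) (e : CTailData) (f : COTailData)
    (i i' : ℕ) : MI :=
  (((uC S C xs ys tab d e i i').mulInt ((f.θpD : ℤ) + f.θpN)).divNat f.θpD).add
    (if i = i' then ((cSBox S C d).mulInt ((f.θpN : ℤ) + f.θpD)).divNat f.θpN else MI.ofInt S 0)

/-- The boxed entry of the odd door's matrix `S(i,i') = K − Schur_K − U'`. [cite: Yoshida1992HermitianForms, §7 pp. 305–312] -/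
def cellCO (S : ℕ) (C : Consts) (xs ys : List MI) (LQ : MI) (tab : List IdxRec) (P : MI) (stab dtab : List MI)
    (d : CCellData) (e : CTailData) (f : COTailData) (i i' : ℕ) : MI :=
  ((entryCO S C xs ys LQ tab P stab dtab i i').sub
      (schurCO S C xs ys LQ tab P stab dtab d.wbits d.wN d.B i i' (2 * (d.B3 - d.B)))).sub
    (tailCO S C xs ys tab d e f i i')

/-- Header checks: the parity-0 header, `θ' > 0`, `P.lo > 0` (the `sech` off-diagonal division), `B < B₃`.
[cite: Moore1966, Ch. 3 (interval arithmetic: inclusion property)] -/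
def checkCellCOHead (P : MI) (d : CCellData) (e : CTailData) (f : COTailData) : Bool :=
  checkCellCHead d e && decide (0 < f.θpN) && decide (0 < f.θpD) && decide (0 < P.lo) && decide (d.B < d.B3)

/-- Row-range cell check `i₀ ≤ i < i₀ + n` against integer midpoints `D` (unit `2^{−c}`, radius `ρ`), as in `checkCellCRows`.
[cite: Moore1966, Ch. 3 (interval arithmetic: inclusion property)] -/
def checkCellCORows (S : ℕ) (C : Consts) (xs ys : List MI) (LQ : MI) (tab : List IdxRec) (P : MI) (stab dtab : List MI)
    (d : CCellData) (e : CTailData) (f : COTailData) (c : ℕ) (ρ : ℤ) (D : List (List ℤ)) (i0 n : ℕ) : Bool :=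
  (List.range' i0 n).all fun i ↦ (List.range (2 * d.B - 1)).all fun i' ↦
    enclCheck S c ρ (PsdDyadic.getMZ D i i') (cellCO S C xs ys LQ tab P stab dtab d e f i i')


/-! ## Soundness, part 1: the bonus at signed modes, entries, Schur sums -/

variable {S : ℕ} {a : ℝ} {q : ℕ}

/-- `ι(κ(i)) = i`. [folklore] -/
theorem iota_modeOfIdx (i : ℕ) :
    (if (0 : ℤ) < modeOfIdx i then 2 * (modeOfIdx i).natAbs - 1 else 2 * (modeOfIdx i).natAbs) = i := by
  unfold modeOfIdx; exact kappa_iota i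

/-- The enumeration `κ` is injective. [folklore] -/
theorem modeOfIdx_inj {i j : ℕ} (h : modeOfIdx i = modeOfIdx j) : i = j := by
  rw [← iota_modeOfIdx i, ← iota_modeOfIdx j, h]

/-- The bonus entry is even in the pair of modes. [folklore] -/
theorem bonusE_neg_neg (a : ℝ) (n m : ℤ) : bonusE a (-n) (-m) = bonusE a n m := by
  unfold bonusE
  rw [sechIncrCoeff_neg_neg]
  simp only [neg_inj]

/-- The bonus box on the diagonal reads the table at `|n|`. [folklore] -/
theorem bonusBoxZ_neg_diag (S : ℕ) (P : MI) (stab dtab : List MI) (n : ℤ) :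
    bonusBoxZ S P stab dtab (-n) (-n) = bonusBoxZ S P stab dtab n n := by
  unfold bonusBoxZ sechBoxZ
  simp only [if_true, Int.natAbs_neg]

/-- `bonusBoxZ ∋ π δ_{nm} − sechIncrCoeff a n m` at SIGNED modes: `|n| < Bd` on the diagonal (either sign), `|n|, |m| < Ns`.
[cite: Moore1966, Ch. 3 (interval arithmetic: inclusion property)] -/
theorem mem_bonusBoxZ_signed (hS : 0 < S) {P : MI} (hP : MI.mem S Real.pi P) (hPlo : 0 < P.lo) {Ns Bd : ℕ} {stab dtab : List MI}
    (hst : (∀ n : ℕ, n < Ns → MI.mem S (∫ t in Ioc 0 (2 * a), 1 / (2 * Real.cosh (t / 2)) * Real.sin (π * n / a * t)) (stab.getD n default)))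
    (hdt : (∀ n : ℕ, n < Bd → MI.mem S (sechIncrCoeff a n n) (dtab.getD n default))) {n m : ℤ}
    (hnB : n = m → n.natAbs < Bd) (hn : n.natAbs < Ns) (hm : m.natAbs < Ns) :
    MI.mem S (bonusE a n m) (bonusBoxZ S P stab dtab n m) := by
  by_cases hnm : n = m
  · subst hnm
    by_cases h0 : 0 ≤ n
    · exact mem_bonusBoxZ hS hP hPlo hst hdt (fun _ ↦ ⟨h0, hnB rfl⟩) hn hn
    · have hn' : (-n).natAbs < Ns := by rwa [Int.natAbs_neg]
      have h := mem_bonusBoxZ hS hP hPlo hst hdt (n := -n) (m := -n)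
        (fun _ ↦ ⟨by omega, by rw [Int.natAbs_neg]; exact hnB rfl⟩) hn' hn'
      rwa [bonusE_neg_neg, bonusBoxZ_neg_diag] at h
  · exact mem_bonusBoxZ hS hP hPlo hst hdt (fun h ↦ absurd h hnm) hn hm

/-- `entryCO ∋ Re K(κ_i, κ_{i'})` (special-value table below `N`, sine table below `Ns`, diagonal table below `Bd` when `i = i'`).
[cite: Moore1966, Ch. 3 (interval arithmetic: inclusion property)] -/
theorem mem_entryCO (hS : 0 < S) (ha0 : 0 < a) {ks : List PrimeLen} (hks : PrimeData a ks) {C : Consts}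
    (hC : ConstsValid S a ks C) (χ : DirichletCharacter ℂ q) {xs ys : List MI}
    (hx : ∀ i < ks.length, MI.mem S (χ (((ks.getD i default).val : ℕ) : ZMod q)).re (xs.getD i default))
    (hy : ∀ i < ks.length, MI.mem S (χ (((ks.getD i default).val : ℕ) : ZMod q)).im (ys.getD i default))
    {LQ : MI} (hLQ : MI.mem S (Real.log q) LQ) {N : ℕ} {tab : List IdxRec} (hT : TabValid S a ks N tab)
    {P : MI} (hP : MI.mem S Real.pi P) (hPlo : 0 < P.lo) {Ns Bd : ℕ} {stab dtab : List MI}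
    (hst : (∀ n : ℕ, n < Ns → MI.mem S (∫ t in Ioc 0 (2 * a), 1 / (2 * Real.cosh (t / 2)) * Real.sin (π * n / a * t)) (stab.getD n default)))
    (hdt : (∀ n : ℕ, n < Bd → MI.mem S (sechIncrCoeff a n n) (dtab.getD n default)))
    {i i' : ℕ} (hi : i < 2 * N - 1) (hi' : i' < 2 * N - 1) (hiS : i < 2 * Ns - 1) (hi'S : i' < 2 * Ns - 1)
    (hD : i = i' → i < 2 * Bd - 1) :
    MI.mem S ((twistedGramCoeffOddC χ a (modeOfIdx i) (modeOfIdx i')).re) (entryCO S C xs ys LQ tab P stab dtab i i') := by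
  rw [re_twistedGramCoeffOddC]
  unfold entryCO
  exact MI.mem_add (mem_entryC hS ha0 hks hC χ hx hy hLQ hT hi hi')
    (mem_bonusBoxZ_signed hS hP hPlo hst hdt (fun h ↦ natAbs_modeOfIdx_lt (hD (modeOfIdx_inj h)))
      (natAbs_modeOfIdx_lt hiS) (natAbs_modeOfIdx_lt hi'S))

/-- Soundness of `schurCO` (columns `j = 2B−1+c`, `c < n`; a row index `< 2B−1` never meets a column index, so the diagonal
`sech` table is not consulted). [cite: Moore1966, Ch. 3 (interval arithmetic: inclusion property)] -/
theorem mem_schurCO (hS : 0 < S) (ha0 : 0 < a) {ks : List PrimeLen} (hks : PrimeData a ks) {C : Consts}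
    (hC : ConstsValid S a ks C) (χ : DirichletCharacter ℂ q) {xs ys : List MI}
    (hx : ∀ i < ks.length, MI.mem S (χ (((ks.getD i default).val : ℕ) : ZMod q)).re (xs.getD i default))
    (hy : ∀ i < ks.length, MI.mem S (χ (((ks.getD i default).val : ℕ) : ZMod q)).im (ys.getD i default))
    {LQ : MI} (hLQ : MI.mem S (Real.log q) LQ) {N : ℕ} {tab : List IdxRec} (hT : TabValid S a ks N tab)
    {P : MI} (hP : MI.mem S Real.pi P) (hPlo : 0 < P.lo) {Ns Bd : ℕ} {stab dtab : List MI}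
    (hst : (∀ n : ℕ, n < Ns → MI.mem S (∫ t in Ioc 0 (2 * a), 1 / (2 * Real.cosh (t / 2)) * Real.sin (π * n / a * t)) (stab.getD n default)))
    (hdt : (∀ n : ℕ, n < Bd → MI.mem S (sechIncrCoeff a n n) (dtab.getD n default)))
    {wbits : ℕ} {wN : List ℕ} {B i i' : ℕ} (hB : 1 ≤ B) (hiB : i < 2 * B - 1) (hi'B : i' < 2 * B - 1) (hNB : B ≤ N) (hNsB : B ≤ Ns) :
    ∀ n, 2 * B - 1 + n ≤ 2 * N - 1 → 2 * B - 1 + n ≤ 2 * Ns - 1 → (∀ c < n, 0 < wN.getD (c / 2) 0) →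
      MI.mem S (∑ c ∈ Finset.range n,
        (twistedGramCoeffOddC χ a (modeOfIdx i) (modeOfIdx (2 * B - 1 + c))).re *
          (twistedGramCoeffOddC χ a (modeOfIdx i') (modeOfIdx (2 * B - 1 + c))).re /
          ((wN.getD (c / 2) 0 : ℝ) / 2 ^ wbits))
        (schurCO S C xs ys LQ tab P stab dtab wbits wN B i i' n)
  | 0, _, _, _ => by simpa [schurCO] using MI.mem_ofInt S 0
  | n + 1, hn, hnS, hw => by
      rw [Finset.sum_range_succ, schurCO]
      have hjN : 2 * B - 1 + n < 2 * N - 1 := by omega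
      have hjS : 2 * B - 1 + n < 2 * Ns - 1 := by omega
      have hiN : i < 2 * N - 1 := by omega
      have hi'N : i' < 2 * N - 1 := by omega
      have hiS : i < 2 * Ns - 1 := by omega
      have hi'S : i' < 2 * Ns - 1 := by omega
      have hiD : i = 2 * B - 1 + n → i < 2 * Bd - 1 := fun h ↦ by omega
      have hi'D : i' = 2 * B - 1 + n → i' < 2 * Bd - 1 := fun h ↦ by omega
      have hwn : 0 < wN.getD (n / 2) 0 := hw n (by omega)
      refine MI.mem_add (mem_schurCO hS ha0 hks hC χ hx hy hLQ hT hP hPlo hst hdt hB hiB hi'B hNB hNsB n (by omega) (by omega)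
        (fun c hc ↦ hw c (by omega))) ?_
      have h := MI.mem_divNat (MI.mem_mulInt (MI.mem_mul hS
        (mem_entryCO hS ha0 hks hC χ hx hy hLQ hT hP hPlo hst hdt hiN hjN hiS hjS hiD)
        (mem_entryCO hS ha0 hks hC χ hx hy hLQ hT hP hPlo hst hdt hi'N hjN hi'S hjS hi'D))
        ((2 : ℤ) ^ wbits)) hwn
      refine mem_of_eq h ?_
      have hw0 : (wN.getD (n / 2) 0 : ℝ) ≠ 0 := by exact_mod_cast hwn.ne'
      push_cast
      field_simp


/-! ## Soundness, part 2: the tail -/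

/-- The isotropic `sech` tail constant `c_S` (literally as in the door). [cite: Yoshida1992HermitianForms, §7 pp. 305–312] -/
noncomputable def cSReal (a d0 : ℝ) (B B3 : ℕ) : ℝ :=
  ((2 * B - 1 : ℕ) : ℝ) * (2 * (a / Real.pi ^ 2 * (1 + 1 / (B3 : ℝ))) ^ 2 / (((B3 - B : ℕ) : ℝ) * d0))

/-- Soundness of `cSBox`. [cite: Moore1966, Ch. 3 (interval arithmetic: inclusion property)] -/
theorem mem_cSBox (hS : 0 < S) {ks : List PrimeLen} {C : Consts} (hC : ConstsValid S a ks C) {d : CCellData}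
    (hd0 : 0 < d.d0N) (hB30 : 0 < d.B3) (hBB : d.B < d.B3) :
    MI.mem S (cSReal a ((d.d0N : ℝ) / 2 ^ d.wbits) d.B d.B3) (cSBox S C d) := by
  have hπ := hC.invPi
  have hB3B : 0 < d.B3 - d.B := by omega
  have hg := MI.mem_divNat (MI.mem_mulInt (MI.mem_mul hS (MI.mem_mul hS hC.ha hπ) hπ) ((d.B3 : ℤ) + 1)) hB30
  have h := MI.mem_divNat (MI.mem_mulInt (MI.mem_mul hS hg hg) (2 * ((2 * d.B - 1 : ℕ) : ℤ) * 2 ^ d.wbits))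
    (n := (d.B3 - d.B) * d.d0N) (Nat.mul_pos hB3B hd0)
  unfold cSBox
  refine mem_of_eq h ?_
  unfold cSReal
  have hd0' : (d.d0N : ℝ) ≠ 0 := by exact_mod_cast hd0.ne'
  have hB3r : ((d.B3 - d.B : ℕ) : ℝ) ≠ 0 := by exact_mod_cast hB3B.ne'
  have hB3r' : (d.B3 : ℝ) ≠ 0 := by exact_mod_cast hB30.ne'
  have hπ0 : (Real.pi : ℝ) ≠ 0 := Real.pi_ne_zero
  push_cast
  field_simp
  try ring

/-- Peter–Paul bookkeeping: `(1+θ')·U + δ·(1+θ'⁻¹)·V` boxed from boxes of `U`, `V` (`θ' = θpN/θpD`).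
[cite: Moore1966, Ch. 3 (interval arithmetic: inclusion property)] -/
theorem mem_peterPaulCombo {U V : ℝ} {bu bv : MI} (hu : MI.mem S U bu) (hv : MI.mem S V bv) {f : COTailData}
    (hθpN : 0 < f.θpN) (hθpD : 0 < f.θpD) (i i' : ℕ) :
    MI.mem S ((1 + (f.θpN : ℝ) / f.θpD) * U + (if i = i' then (1 + ((f.θpN : ℝ) / f.θpD)⁻¹) * V else 0))
      ((((bu.mulInt ((f.θpD : ℤ) + f.θpN)).divNat f.θpD).add
        (if i = i' then ((bv.mulInt ((f.θpN : ℤ) + f.θpD)).divNat f.θpN) else MI.ofInt S 0))) := by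
  have hθpN' : (f.θpN : ℝ) ≠ 0 := by exact_mod_cast hθpN.ne'
  have hθpD' : (f.θpD : ℝ) ≠ 0 := by exact_mod_cast hθpD.ne'
  have h1 := MI.mem_divNat (MI.mem_mulInt hu ((f.θpD : ℤ) + f.θpN)) hθpD
  by_cases hii : i = i'
  · rw [if_pos hii, if_pos hii]
    have h2 := MI.mem_divNat (MI.mem_mulInt hv ((f.θpN : ℤ) + f.θpD)) hθpN
    refine mem_of_eq (MI.mem_add h1 h2) ?_
    push_cast
    field_simp
  · rw [if_neg hii, if_neg hii]
    refine mem_of_eq (MI.mem_add h1 (MI.mem_ofInt S 0)) ?_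
    push_cast
    field_simp

/-- Soundness of `tailCO`: `(1+θ')·uCReal + δ·(1+θ'⁻¹)·c_S`. [cite: Moore1966, Ch. 3 (interval arithmetic: inclusion property)] -/
theorem mem_tailCO (hS : 0 < S) {ks : List PrimeLen} (hks : PrimeData a ks) {C : Consts} (hC : ConstsValid S a ks C)
    (χ : DirichletCharacter ℂ q) {xs ys : List MI}
    (hx : ∀ i < ks.length, MI.mem S (χ (((ks.getD i default).val : ℕ) : ZMod q)).re (xs.getD i default))
    (hy : ∀ i < ks.length, MI.mem S (χ (((ks.getD i default).val : ℕ) : ZMod q)).im (ys.getD i default))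
    {N : ℕ} {tab : List IdxRec} (hT : TabValid S a ks N tab) {d : CCellData} {e : CTailData} {f : COTailData}
    (hθN : 0 < e.θN) (hθD : 0 < e.θD) (hηN : 0 < e.ηN) (hηD : 0 < e.ηD) (hd0 : 0 < d.d0N) (hB3 : 2 ≤ d.B3) (hB30 : 0 < d.B3)
    (hBB : d.B < d.B3) (hθpN : 0 < f.θpN) (hθpD : 0 < f.θpD)
    {Cc : ℝ} (hCC : MI.mem S Cc d.CC) {i i' : ℕ} (hi : i < 2 * N - 1) (hi' : i' < 2 * N - 1) :
    MI.mem S ((1 + (f.θpN : ℝ) / f.θpD) * uCReal (∑ k ∈ weilPrimeIndex a, (ArithmeticFunction.vonMangoldt k : ℝ) / Real.sqrt k) Cc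
          ((e.θN : ℝ) / e.θD) ((e.ηN : ℝ) / e.ηD) ((d.d0N : ℝ) / 2 ^ d.wbits) d.B d.B3
          (fun i ↦ ((Complex.digamma (1 / 4 + ((freq a (modeOfIdx i) : ℝ) : ℂ) / 2 * Complex.I)).im / 2
            + (∑ k ∈ weilPrimeIndex a, (ArithmeticFunction.vonMangoldt k : ℝ) / Real.sqrt k *
                ((χ (k : ZMod q)).re * Real.sin (freq a (modeOfIdx i) * Real.log k) +
                  (χ (k : ZMod q)).im * Real.cos (freq a (modeOfIdx i) * Real.log k)))
            - archExpSumSin a (modeOfIdx i)) / Real.pi) i i'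
        + (if i = i' then (1 + ((f.θpN : ℝ) / f.θpD)⁻¹) * cSReal a ((d.d0N : ℝ) / 2 ^ d.wbits) d.B d.B3 else 0))
      (tailCO S C xs ys tab d e f i i') := by
  unfold tailCO
  exact mem_peterPaulCombo (mem_uC hS hks hC χ hx hy hT hθN hθD hηN hηD hd0 hB3 hB30 hCC hi hi' (e := e))
    (mem_cSBox hS hC hd0 hB30 hBB) hθpN hθpD i i'


end TwistedEncl

end Summit.Ventures.WeilGRH
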